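import Mathlib
import Literature.NumberTheory.EllipticCurves.RealLatticePeriodProofs
import Literature.NumberTheory.EllipticCurves.ComplexTorusAddProofs
import Literature.NumberTheory.EllipticCurves.UniformizationProofs
import HarnessLib

/-!
# Stub `stub_realDictionary` — crux `TorsionLogs.NeronTorsionSector`, line `registered`

The **real Weierstrass dictionary** of the identity component `x ≥ e₁` of the real curve
`y² = f(x) = 4x³ − g₂x − g₃` (`g₂, g₃ ∈ ℝ`, `g₂³ ≠ 27g₃²`, `e₁` the largest real root of `f`):
with `Λ` the lattice with invariants `g₂, g₃` (Uniformization Theorem, tree: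
`PeriodPair.uniformization_holds`; it is a real lattice by `uniformization_unique_holds` +
`isReal_of_g₂_g₃_real`), `ω = Ω₀` its least positive real period and `X = ℘|ℝ`, `Y = ℘′|ℝ`
(`PeriodPair.weierstrassPRe`, `derivWeierstrassPRe`), we package everything the assembly of the crux
consumes as statements about plain real functions: `ω = 2∫_{e₁}^∞ dx/√f`, parity and
`ω`-periodicity, `X(ω/2) = e₁`, `Y(ω/2) = 0`, `Y² = f(X)`, the sign of `Y`, strict monotonicity
and surjectivity of `X : (0, ω/2) → (e₁, ∞)`, the incomplete integral `∫_{X u}^∞ dx/√f = u`,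
`X′ = Y`, `Y′ = 6X² − g₂/2`, the chord addition law for `X` and `Y`, the duplication formulas, and
`X u = X v ↔ u ≡ ±v (mod ω)` on `(0, ω)`.

Everything is read off the tree's theory of `℘` of a real lattice
(`Literature/NumberTheory/EllipticCurves/RealLatticePeriodProofs.lean`,
`ComplexTorusAddProofs.lean`, `WeierstrassAdditionProofs.lean`,
`RealLatticePeriodHalfPeriodsProofs.lean`); the only new arguments are

* the identification `X(ω/2) = e₁`: `X(ω/2)` is a real root of `f` (`Y(ω/2) = 0`), it is `≤ e₁`
  because `f > 0` beyond `e₁`, and a root `e₁ > X(ω/2)` would be a value `X t`, `t ∈ (0, ω/2)`,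
  with `f(X t) = (Y t)² > 0`;
* the incomplete integral, by the substitution `x = X(s)` on `(0, u)` (as in the tree's
  `IsReal.integral_Ioi_inv_sqrt_cubic_eq`, which is the case `u = ω/2`);
* real lattice points: a real `t ∈ Λ` with `|t| < ω` is `0`, with `0 < t < 2ω` is `ω`.

## References

* D. F. Lawden, *Elliptic Functions and Applications* (1989), §6.7, §6.8 (6.8.4), §6.11,
  §6.12 (6.12.4).
* E. T. Whittaker, G. N. Watson, *A Course of Modern Analysis*, §20.3, §20.32.
* M. Kontsevich, D. Zagier, *Periods* (2001), §1.2.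
-/

-- single-conjunct summit: Sub = Summit, so the namespace segment repeats by design (CONVENTIONS §2)
set_option linter.dupNamespace false

noncomputable section

open Set MeasureTheory Filter Topology
open scoped PeriodPair

namespace Summit.KontsevichZagierPeriods.KontsevichZagierPeriods.Cruxes.NeronTorsionSector.Translation

variable {L : PeriodPair}

/-! ### Real lattice points -/

/-- A real lattice point `t` of a real lattice with `|t| < Ω₀` is `0` (minimality of `Ω₀`, and
`−t ∈ Λ`). [folklore] -/
theorem eq_zero_of_ofReal_mem_lattice (hR : L.IsReal) {t : ℝ} (ht : (t : ℂ) ∈ L.lattice)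
    (h1 : -L.minRealPeriod < t) (h2 : t < L.minRealPeriod) : t = 0 := by
  by_contra h0
  rcases lt_or_gt_of_ne h0 with h | h
  · have hmem : ((-t : ℝ) : ℂ) ∈ L.lattice := by
      rw [Complex.ofReal_neg]
      exact neg_mem ht
    have := hR.minRealPeriod_le ⟨by linarith, hmem⟩
    linarith
  · have := hR.minRealPeriod_le ⟨h, ht⟩
    linarith

/-- A real lattice point `t` of a real lattice with `0 < t < 2Ω₀` is `Ω₀`. [folklore] -/
theorem eq_minRealPeriod_of_ofReal_mem_lattice (hR : L.IsReal) {t : ℝ} (ht : (t : ℂ) ∈ L.lattice)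
    (h1 : 0 < t) (h2 : t < 2 * L.minRealPeriod) : t = L.minRealPeriod := by
  have hle := hR.minRealPeriod_le ⟨h1, ht⟩
  have hmem : ((t - L.minRealPeriod : ℝ) : ℂ) ∈ L.lattice := by
    rw [Complex.ofReal_sub]
    exact sub_mem ht hR.minRealPeriod_mem_lattice
  have := eq_zero_of_ofReal_mem_lattice hR hmem (by linarith) (by linarith)
  linarith

/-- For `u ∈ (0, Ω₀)`, `u ≠ Ω₀/2`: `2u ∉ Λ`. [folklore] -/
theorem two_mul_ofReal_notMem_lattice (hR : L.IsReal) {u : ℝ} (hu : u ∈ Ioo 0 L.minRealPeriod)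
    (hne : u ≠ L.minRealPeriod / 2) : 2 * (u : ℂ) ∉ L.lattice := by
  intro hmem
  have hmem' : ((2 * u : ℝ) : ℂ) ∈ L.lattice := by push_cast; exact hmem
  have := eq_minRealPeriod_of_ofReal_mem_lattice hR hmem' (by linarith [hu.1]) (by linarith [hu.2])
  exact hne (by linarith)

/-! ### Parity and periodicity on the real axis -/

/-- `℘` is `Ω₀`-periodic on the real axis. [folklore] -/
theorem weierstrassPRe_add_minRealPeriod (hR : L.IsReal) (u : ℝ) :
    L.weierstrassPRe (u + L.minRealPeriod) = L.weierstrassPRe u := by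
  have h := L.weierstrassP_add_coe (u : ℂ) ⟨_, hR.minRealPeriod_mem_lattice⟩
  rw [PeriodPair.weierstrassPRe_def, PeriodPair.weierstrassPRe_def, ← h]
  congr 2
  push_cast
  rfl

/-- `℘` is even on the real axis. [folklore] -/
theorem weierstrassPRe_neg_arg (L : PeriodPair) (u : ℝ) :
    L.weierstrassPRe (-u) = L.weierstrassPRe u := by
  rw [PeriodPair.weierstrassPRe_def, PeriodPair.weierstrassPRe_def, Complex.ofReal_neg,
    L.weierstrassP_neg]

/-- `℘′` is `Ω₀`-periodic on the real axis. [folklore] -/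
theorem derivWeierstrassPRe_add_minRealPeriod (hR : L.IsReal) (u : ℝ) :
    L.derivWeierstrassPRe (u + L.minRealPeriod) = L.derivWeierstrassPRe u := by
  have h := L.derivWeierstrassP_add_coe (u : ℂ) ⟨_, hR.minRealPeriod_mem_lattice⟩
  rw [PeriodPair.derivWeierstrassPRe_def, PeriodPair.derivWeierstrassPRe_def, ← h]
  congr 2
  push_cast
  rfl

/-- `℘′` is odd on the real axis. [folklore] -/
theorem derivWeierstrassPRe_neg_arg (L : PeriodPair) (u : ℝ) :
    L.derivWeierstrassPRe (-u) = -L.derivWeierstrassPRe u := by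
  rw [PeriodPair.derivWeierstrassPRe_def, PeriodPair.derivWeierstrassPRe_def, Complex.ofReal_neg,
    L.derivWeierstrassP_neg, Complex.neg_re]

/-- `℘′(Ω₀/2) = 0` on the real axis (Lawden (6.7.5)). [folklore] -/
theorem derivWeierstrassPRe_half (hR : L.IsReal) :
    L.derivWeierstrassPRe (L.minRealPeriod / 2) = 0 := by
  rw [PeriodPair.derivWeierstrassPRe_def, hR.derivWeierstrassP_minRealPeriod_div_two,
    Complex.zero_re]

/-- Off the half-period, `℘ > e₁ = ℘(Ω₀/2)` on `(0, Ω₀)` (strict monotonicity on `(0, Ω₀/2]` and the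
symmetry `℘(Ω₀ − t) = ℘(t)`). [folklore] -/
theorem weierstrassPRe_half_lt (hR : L.IsReal) {u : ℝ} (hu : u ∈ Ioo 0 L.minRealPeriod)
    (hne : u ≠ L.minRealPeriod / 2) :
    L.weierstrassPRe (L.minRealPeriod / 2) < L.weierstrassPRe u := by
  have hΩ := hR.minRealPeriod_pos
  have hanti := hR.strictAntiOn_weierstrassPRe
  rcases lt_or_gt_of_ne hne with h | h
  · exact hanti ⟨hu.1, h.le⟩ ⟨by linarith, le_rfl⟩ h
  · rw [← hR.weierstrassPRe_minRealPeriod_sub u]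
    exact hanti ⟨by linarith [hu.2], by linarith⟩ ⟨by linarith, le_rfl⟩ (by linarith)

/-! ### The identification `℘(Ω₀/2) = e₁` and the incomplete elliptic integral -/

/-- **`℘(Ω₀/2)` is the largest real root.** If `e₁` is a root of `f = 4x³ − g₂x − g₃` with `f > 0`
on `(e₁, ∞)`, then `℘(Ω₀/2) = e₁`: `℘(Ω₀/2)` is a root (`℘′(Ω₀/2) = 0`), so `℘(Ω₀/2) ≤ e₁`; and
`e₁ > ℘(Ω₀/2)` would make `e₁ = ℘(t)` for some `t ∈ (0, Ω₀/2)` with `f(e₁) = ℘′(t)² > 0`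
(Lawden §6.8, (6.8.4): `e₁` is the largest root). [cite: Lawden1989, §6.8 (6.8.4) and §6.11] -/
theorem weierstrassPRe_half_eq (hR : L.IsReal) {e₁ : ℝ}
    (he : 4 * e₁ ^ 3 - L.g₂.re * e₁ - L.g₃.re = 0)
    (hpos : ∀ x, e₁ < x → 0 < 4 * x ^ 3 - L.g₂.re * x - L.g₃.re) :
    L.weierstrassPRe (L.minRealPeriod / 2) = e₁ := by
  have hΩ := hR.minRealPeriod_pos
  have hsq : ∀ u ∈ Ioo 0 L.minRealPeriod, L.derivWeierstrassPRe u ^ 2 =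
      4 * L.weierstrassPRe u ^ 3 - L.g₂.re * L.weierstrassPRe u - L.g₃.re :=
    fun u hu ↦ hR.derivWeierstrassPRe_sq (hR.ofReal_notMem_lattice hu.1 hu.2)
  have hfe : 4 * L.weierstrassPRe (L.minRealPeriod / 2) ^ 3 -
      L.g₂.re * L.weierstrassPRe (L.minRealPeriod / 2) - L.g₃.re = 0 := by
    rw [← hsq _ ⟨by linarith, by linarith⟩, derivWeierstrassPRe_half hR]
    ring
  rcases lt_trichotomy (L.weierstrassPRe (L.minRealPeriod / 2)) e₁ with hlt | heq | hgt
  · exfalso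
    have hmem : e₁ ∈ Ioi (L.weierstrassPRe (L.minRealPeriod / 2)) := hlt
    rw [← hR.image_weierstrassPRe_Ioo] at hmem
    obtain ⟨t, ht, hte⟩ := hmem
    have h1 := hsq t ⟨ht.1, by linarith [ht.2]⟩
    rw [hte, he] at h1
    have h2 : L.derivWeierstrassPRe t < 0 := hR.derivWeierstrassPRe_neg ht.1 ht.2
    nlinarith
  · exact heq
  · exact absurd hfe (hpos _ hgt).ne'

/-- **The incomplete elliptic integral of the first kind** (Lawden §6.12, (6.12.3)–(6.12.4) is the
complete case `u = Ω₀/2`): for `u ∈ (0, Ω₀/2]`, `∫_{℘(u)}^{∞} dx/√(4x³ − g₂x − g₃) = u`, by the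
substitution `x = ℘(s)`, `s ∈ (0, u)`, `|℘′(s)|/√f(℘(s)) = 1`. [cite: Lawden1989, §6.12 (6.12.4)] -/
theorem integral_Ioi_weierstrassPRe_eq (hR : L.IsReal) {u : ℝ}
    (hu : u ∈ Ioc 0 (L.minRealPeriod / 2)) :
    ∫ x in Ioi (L.weierstrassPRe u), (Real.sqrt (4 * x ^ 3 - L.g₂.re * x - L.g₃.re))⁻¹ = u := by
  have hΩ := hR.minRealPeriod_pos
  have hanti := hR.strictAntiOn_weierstrassPRe
  have hnot : ∀ s ∈ Ioo 0 u, (s : ℂ) ∉ L.lattice :=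
    fun s hs ↦ hR.ofReal_notMem_lattice hs.1 (by linarith [hs.2, hu.2])
  have himg : L.weierstrassPRe '' Ioo 0 u = Ioi (L.weierstrassPRe u) := by
    apply Subset.antisymm
    · rintro _ ⟨s, hs, rfl⟩
      exact hanti ⟨hs.1, hs.2.le.trans hu.2⟩ hu hs.2
    · intro x hx
      have hx' : x ∈ Ioi (L.weierstrassPRe (L.minRealPeriod / 2)) :=
        lt_of_le_of_lt (hanti.antitoneOn hu ⟨by linarith, le_rfl⟩ hu.2) hx
      rw [← hR.image_weierstrassPRe_Ioo] at hx'
      obtain ⟨s, hs, rfl⟩ := hx'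
      refine ⟨s, ⟨hs.1, ?_⟩, rfl⟩
      by_contra hsu
      exact (not_lt.mpr (hanti.antitoneOn hu ⟨hs.1, hs.2.le⟩ (not_lt.mp hsu))) hx
  have hinj : InjOn L.weierstrassPRe (Ioo 0 u) :=
    hanti.injOn.mono (Ioo_subset_Ioc_self.trans (Ioc_subset_Ioc_right hu.2))
  rw [← himg, integral_image_eq_integral_abs_deriv_smul measurableSet_Ioo
      (fun s hs ↦ (PeriodPair.hasDerivAt_weierstrassPRe (hnot s hs)).hasDerivWithinAt) hinj]
  have heq : EqOn (fun s ↦ |L.derivWeierstrassPRe s| •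
      (Real.sqrt (4 * L.weierstrassPRe s ^ 3 - L.g₂.re * L.weierstrassPRe s - L.g₃.re))⁻¹)
      (fun _ ↦ (1 : ℝ)) (Ioo 0 u) := by
    intro s hs
    simp only [smul_eq_mul]
    rw [← hR.derivWeierstrassPRe_sq (hnot s hs), Real.sqrt_sq_eq_abs,
      mul_inv_cancel₀ (abs_ne_zero.mpr
        (hR.derivWeierstrassPRe_neg hs.1 (lt_of_lt_of_le hs.2 hu.2)).ne)]
  rw [setIntegral_congr_fun measurableSet_Ioo heq, setIntegral_const, smul_eq_mul, mul_one,
    Real.volume_real_Ioo_of_le hu.1.le, sub_zero]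

/-! ### Derivatives, addition and duplication on the real axis -/

/-- `(℘′|ℝ)′ = 6℘² − g₂/2` at real non-lattice points (real part of the tree's
`PeriodPair.hasDerivAt_derivWeierstrassP`, Whittaker–Watson §20.22). [folklore] -/
theorem hasDerivAt_derivWeierstrassPRe (hR : L.IsReal) {u : ℝ} (hu : (u : ℂ) ∉ L.lattice) :
    HasDerivAt L.derivWeierstrassPRe (6 * L.weierstrassPRe u ^ 2 - L.g₂.re / 2) u := by
  have h := (L.hasDerivAt_derivWeierstrassP hu).real_of_complex
  rw [← hR.ofReal_weierstrassPRe, ← hR.ofReal_g₂_re] at h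
  have e : ((6 : ℂ) * (L.weierstrassPRe u : ℂ) ^ 2 - (L.g₂.re : ℂ) / 2).re =
      6 * L.weierstrassPRe u ^ 2 - L.g₂.re / 2 := by norm_cast
  rw [e] at h
  exact h

/-- **Addition theorem on the real axis** (chord law for `X = ℘|ℝ` and `Y = ℘′|ℝ`): for real
`u, v ∉ Λ` with `℘(u) ≠ ℘(v)` and `q = (Y u − Y v)/(X u − X v)`,
`X(u + v) = q²/4 − X u − X v` and `Y(u + v) = −(Y u + q (X(u + v) − X u))` (real parts of the
tree's `weierstrassP_add_holds`, `derivWeierstrassP_add_of_ne`).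
[cite: Lawden1989, §6.8] [cite: ArmitageEberlein2001, §7.4.2 Thm 7.2 eq. (7.68)] -/
theorem weierstrassPRe_add (hR : L.IsReal) {u v : ℝ} (hu : (u : ℂ) ∉ L.lattice)
    (hv : (v : ℂ) ∉ L.lattice) (hne : L.weierstrassPRe u ≠ L.weierstrassPRe v) :
    L.weierstrassPRe (u + v) =
        ((L.derivWeierstrassPRe u - L.derivWeierstrassPRe v) /
            (L.weierstrassPRe u - L.weierstrassPRe v)) ^ 2 / 4 -
          L.weierstrassPRe u - L.weierstrassPRe v ∧
      L.derivWeierstrassPRe (u + v) =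
        -(L.derivWeierstrassPRe u + (L.derivWeierstrassPRe u - L.derivWeierstrassPRe v) /
          (L.weierstrassPRe u - L.weierstrassPRe v) *
            (L.weierstrassPRe (u + v) - L.weierstrassPRe u)) := by
  have hne' : ℘[L] u ≠ ℘[L] v := by
    rw [← hR.ofReal_weierstrassPRe, ← hR.ofReal_weierstrassPRe, Ne, Complex.ofReal_inj]
    exact hne
  have hx := L.weierstrassP_add_holds u v hu hv hne'
  have hy := PeriodPair.derivWeierstrassP_add_of_ne hu hv hne'
  have e1 : ℘[L] (↑u + ↑v) = ((L.weierstrassPRe (u + v) : ℝ) : ℂ) := by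
    rw [hR.ofReal_weierstrassPRe, Complex.ofReal_add]
  have e2 : ℘'[L] (↑u + ↑v) = ((L.derivWeierstrassPRe (u + v) : ℝ) : ℂ) := by
    rw [hR.ofReal_derivWeierstrassPRe, Complex.ofReal_add]
  rw [e1, ← hR.ofReal_weierstrassPRe u, ← hR.ofReal_weierstrassPRe v,
    ← hR.ofReal_derivWeierstrassPRe u, ← hR.ofReal_derivWeierstrassPRe v] at hx
  rw [e1, e2, ← hR.ofReal_weierstrassPRe u, ← hR.ofReal_weierstrassPRe v,
    ← hR.ofReal_derivWeierstrassPRe u, ← hR.ofReal_derivWeierstrassPRe v] at hy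
  exact ⟨by exact_mod_cast hx, by exact_mod_cast hy⟩

/-- **Duplication formulas on the real axis**: for `u ∈ (0, Ω₀)`, `u ≠ Ω₀/2` (so `u, 2u ∉ Λ` and
`Y u ≠ 0`), with `m = (6 (X u)² − g₂/2)/Y u`: `X(2u) = m²/4 − 2 X u` and
`Y(2u) = −(Y u + m (X(2u) − X u))` (real parts of the tree's `weierstrassP_two_mul_holds`,
`derivWeierstrassP_two_mul_of_notMem`, with `℘″ = 6℘² − g₂/2`).
[cite: ArmitageEberlein2001, §7.4.2 Cor. 7.1] -/
theorem weierstrassPRe_two_mul (hR : L.IsReal) {u : ℝ} (hu : u ∈ Ioo 0 L.minRealPeriod)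
    (hne : u ≠ L.minRealPeriod / 2) :
    L.weierstrassPRe (2 * u) =
        ((6 * L.weierstrassPRe u ^ 2 - L.g₂.re / 2) / L.derivWeierstrassPRe u) ^ 2 / 4 -
          2 * L.weierstrassPRe u ∧
      L.derivWeierstrassPRe (2 * u) =
        -(L.derivWeierstrassPRe u + (6 * L.weierstrassPRe u ^ 2 - L.g₂.re / 2) /
          L.derivWeierstrassPRe u * (L.weierstrassPRe (2 * u) - L.weierstrassPRe u)) := by
  have hu' : (u : ℂ) ∉ L.lattice := hR.ofReal_notMem_lattice hu.1 hu.2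
  have h2u : 2 * (u : ℂ) ∉ L.lattice := two_mul_ofReal_notMem_lattice hR hu hne
  have h0 : ℘'[L] u ≠ 0 := fun h ↦
    h2u (L.two_mul_mem_lattice_of_derivWeierstrassP_eq_zero hu' h)
  have hx := L.weierstrassP_two_mul_holds u hu' h0
  have hy := PeriodPair.derivWeierstrassP_two_mul_of_notMem hu' h2u
  rw [L.deriv_derivWeierstrassP hu'] at hx hy
  have e1 : ℘[L] (2 * ↑u) = ((L.weierstrassPRe (2 * u) : ℝ) : ℂ) := by
    rw [hR.ofReal_weierstrassPRe]; push_cast; rfl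
  have e2 : ℘'[L] (2 * ↑u) = ((L.derivWeierstrassPRe (2 * u) : ℝ) : ℂ) := by
    rw [hR.ofReal_derivWeierstrassPRe]; push_cast; rfl
  rw [e1, ← hR.ofReal_weierstrassPRe u, ← hR.ofReal_derivWeierstrassPRe u,
    ← hR.ofReal_g₂_re] at hx
  rw [e1, e2, ← hR.ofReal_weierstrassPRe u, ← hR.ofReal_derivWeierstrassPRe u,
    ← hR.ofReal_g₂_re] at hy
  exact ⟨by exact_mod_cast hx, by exact_mod_cast hy⟩

/-- **`℘ u = ℘ v ↔ u ≡ ±v`** on the real period interval: for `u, v ∈ (0, Ω₀)`,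
`℘(u) = ℘(v) ↔ u = v ∨ u + v = Ω₀` (the tree's `weierstrassP_eq_weierstrassP_iff`:
`u ± v ∈ Λ`, and the real lattice points in `(−Ω₀, Ω₀)`, `(0, 2Ω₀)`). [folklore] -/
theorem weierstrassPRe_eq_iff (hR : L.IsReal) {u v : ℝ} (hu : u ∈ Ioo 0 L.minRealPeriod)
    (hv : v ∈ Ioo 0 L.minRealPeriod) :
    L.weierstrassPRe u = L.weierstrassPRe v ↔ (u = v ∨ u + v = L.minRealPeriod) := by
  have hu' : (u : ℂ) ∉ L.lattice := hR.ofReal_notMem_lattice hu.1 hu.2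
  have hv' : (v : ℂ) ∉ L.lattice := hR.ofReal_notMem_lattice hv.1 hv.2
  rw [← Complex.ofReal_inj, hR.ofReal_weierstrassPRe, hR.ofReal_weierstrassPRe,
    L.weierstrassP_eq_weierstrassP_iff hu' hv']
  constructor
  · rintro (h | h)
    · right
      exact eq_minRealPeriod_of_ofReal_mem_lattice hR (t := u + v) (by push_cast; exact h)
        (by linarith [hu.1, hv.1]) (by linarith [hu.2, hv.2])
    · left
      have := eq_zero_of_ofReal_mem_lattice hR (t := u - v) (by push_cast; exact h)
        (by linarith [hu.1, hv.2]) (by linarith [hu.2, hv.1])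
      linarith
  · rintro (rfl | h)
    · right
      rw [sub_self]
      exact zero_mem _
    · left
      have e : (u : ℂ) + v = ((u + v : ℝ) : ℂ) := by push_cast; rfl
      rw [e, h]
      exact hR.minRealPeriod_mem_lattice

/-! ### The dictionary -/

/-- **STUB S1 (`stub_realDictionary`) — the real Weierstrass dictionary of the identity
component.** For a real cubic `f = 4x³ − g₂x − g₃` with `g₂³ ≠ 27g₃²` and largest root `e₁`
(`f(e₁) = 0`, `f > 0` beyond), there are `ω > 0` and real functions `X, Y` (the restrictions to `ℝ` of
`℘`, `℘′` of the real lattice with invariants `g₂, g₃`; `ω` its least positive real period) with: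
`ω = 2∫_{e₁}^∞ dx/√f`; `X` even and `Y` odd, both `ω`-periodic; `X(ω/2) = e₁`, `Y(ω/2) = 0`;
`Y² = f(X)` off `ωℤ`; `Y < 0` on `(0, ω/2)`; `X` strictly decreasing on `(0, ω/2]` onto `[e₁, ∞)`;
`∫_{X u}^∞ dx/√f = u` for `u ∈ (0, ω/2]`; `X′ = Y`, `Y′ = 6X² − g₂/2`; the addition theorem for `X`
AND `Y` (chord law) and the duplication formulas; `X u = X v ↔ u ≡ ±v`. The lattice comes from
`PeriodPair.uniformization_holds`, is real by `isReal_of_g₂_g₃_real` + `uniformization_unique_holds`,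
and the conjuncts are the lemmas of this file and of `RealLatticePeriodProofs.lean`.
[cite: Lawden1989, §6.8 (6.8.4), §6.11, §6.12 (6.12.4)] [cite: WhittakerWatson1927, §20.3] -/
theorem stub_realDictionary :
    ∀ (g₂ g₃ e₁ : ℝ) (f : ℝ → ℝ),
    (∀ x, f x = 4 * x ^ 3 - g₂ * x - g₃) → g₂ ^ 3 - 27 * g₃ ^ 2 ≠ 0 → f e₁ = 0 →
    (∀ x, e₁ < x → 0 < f x) →
    ∃ (ω : ℝ) (X Y : ℝ → ℝ), 0 < ω ∧
      ω = 2 * ∫ x in Set.Ioi e₁, (Real.sqrt (f x))⁻¹ ∧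
      (∀ u, X (u + ω) = X u) ∧ (∀ u, X (-u) = X u) ∧ (∀ u, Y (u + ω) = Y u) ∧ (∀ u, Y (-u) = -Y u) ∧
      X (ω / 2) = e₁ ∧ Y (ω / 2) = 0 ∧
      (∀ u ∈ Set.Ioo 0 ω, u ≠ ω / 2 → e₁ < X u) ∧
      (∀ u ∈ Set.Ioo 0 ω, Y u ^ 2 = f (X u)) ∧
      (∀ u ∈ Set.Ioo 0 (ω / 2), Y u < 0) ∧
      StrictAntiOn X (Set.Ioc 0 (ω / 2)) ∧
      (∀ x, e₁ < x → ∃ u ∈ Set.Ioo 0 (ω / 2), X u = x) ∧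
      (∀ u ∈ Set.Ioc 0 (ω / 2), ∫ x in Set.Ioi (X u), (Real.sqrt (f x))⁻¹ = u) ∧
      (∀ u ∈ Set.Ioo 0 ω, HasDerivAt X (Y u) u ∧ HasDerivAt Y (6 * X u ^ 2 - g₂ / 2) u) ∧
      (∀ u ∈ Set.Ioo 0 ω, ∀ v ∈ Set.Ioo 0 ω, u + v ≠ ω → X u ≠ X v →
        X (u + v) = ((Y u - Y v) / (X u - X v)) ^ 2 / 4 - X u - X v ∧
        Y (u + v) = -(Y u + (Y u - Y v) / (X u - X v) * (X (u + v) - X u))) ∧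
      (∀ u ∈ Set.Ioo 0 ω, u ≠ ω / 2 →
        X (2 * u) = ((6 * X u ^ 2 - g₂ / 2) / Y u) ^ 2 / 4 - 2 * X u ∧
        Y (2 * u) = -(Y u + (6 * X u ^ 2 - g₂ / 2) / Y u * (X (2 * u) - X u))) ∧
      (∀ u ∈ Set.Ioo 0 ω, ∀ v ∈ Set.Ioo 0 ω, X u = X v ↔ (u = v ∨ u + v = ω)) := by
  intro g₂ g₃ e₁ f hf hdisc he hpos
  obtain ⟨L, hL2, hL3⟩ :=
    PeriodPair.uniformization_holds (g₂ : ℂ) (g₃ : ℂ) (by exact_mod_cast hdisc)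
  have hR : L.IsReal := PeriodPair.isReal_of_g₂_g₃_real PeriodPair.uniformization_unique_holds
    (by rw [hL2]; exact Complex.ofReal_im g₂) (by rw [hL3]; exact Complex.ofReal_im g₃)
  have hg2 : L.g₂.re = g₂ := by rw [hL2, Complex.ofReal_re]
  have hg3 : L.g₃.re = g₃ := by rw [hL3, Complex.ofReal_re]
  simp only [hf] at he hpos ⊢
  subst hg2 hg3
  have hΩ := hR.minRealPeriod_pos
  have hnot : ∀ u ∈ Ioo 0 L.minRealPeriod, (u : ℂ) ∉ L.lattice :=
    fun u hu ↦ hR.ofReal_notMem_lattice hu.1 hu.2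
  have hhalf : L.weierstrassPRe (L.minRealPeriod / 2) = e₁ := weierstrassPRe_half_eq hR he hpos
  refine ⟨L.minRealPeriod, L.weierstrassPRe, L.derivWeierstrassPRe, hΩ, ?_,
    weierstrassPRe_add_minRealPeriod hR, weierstrassPRe_neg_arg L,
    derivWeierstrassPRe_add_minRealPeriod hR, derivWeierstrassPRe_neg_arg L, hhalf,
    derivWeierstrassPRe_half hR, ?_, ?_, ?_, hR.strictAntiOn_weierstrassPRe, ?_, ?_, ?_, ?_, ?_, ?_⟩
  · -- the complete integral
    rw [← hhalf, hR.integral_Ioi_inv_sqrt_cubic_eq]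
    ring
  · -- `e₁ < X u` off the half-period
    intro u hu hne
    rw [← hhalf]
    exact weierstrassPRe_half_lt hR hu hne
  · -- the Weierstrass equation
    exact fun u hu ↦ hR.derivWeierstrassPRe_sq (hnot u hu)
  · -- sign of `Y`
    exact fun u hu ↦ hR.derivWeierstrassPRe_neg hu.1 hu.2
  · -- surjectivity onto `(e₁, ∞)`
    intro x hx
    have hx' : x ∈ Ioi (L.weierstrassPRe (L.minRealPeriod / 2)) := by rw [hhalf]; exact hx
    rw [← hR.image_weierstrassPRe_Ioo] at hx'
    obtain ⟨u, hu, rfl⟩ := hx'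
    exact ⟨u, hu, rfl⟩
  · -- the incomplete integral
    exact fun u hu ↦ integral_Ioi_weierstrassPRe_eq hR hu
  · -- derivatives
    exact fun u hu ↦ ⟨PeriodPair.hasDerivAt_weierstrassPRe (hnot u hu),
      hasDerivAt_derivWeierstrassPRe hR (hnot u hu)⟩
  · -- addition
    exact fun u hu v hv _ hne ↦ weierstrassPRe_add hR (hnot u hu) (hnot v hv) hne
  · -- duplication
    exact fun u hu hne ↦ weierstrassPRe_two_mul hR hu hne
  · -- fibres of `X`
    exact fun u hu v hv ↦ weierstrassPRe_eq_iff hR hu hv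

end Summit.KontsevichZagierPeriods.KontsevichZagierPeriods.Cruxes.NeronTorsionSector.Translation
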